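import Literature.Topology.Euclidean.LatticeCubePush
import Literature.Topology.Euclidean.LatticeCubeBoxes
import Literature.Topology.Euclidean.C1Covered
import HarnessLib

/-!
# Pushing a small image off the open cells of a lattice cube complex, dimension by dimension

Topic `Literature/Topology/Euclidean`, continuing `LatticeCubePush.lean` (radial push `rpush`
in one lattice face), `LatticeCubeSkeleton.lean` (skeleta), `LatticeCubeBoxes.lean` (boxes) and
`C1Covered.lean` (general-position smallness). This is the general-position half of cellular
approximation for cube complexes (Hatcher, *Algebraic Topology* (2002), §4.1, proof of Thm. 4.8,
pp. 349–351, with Lemma 4.10 replaced by the Hausdorff-dimension count of `C1Covered.lean`):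

* `LatticeCube.spush G h p`: the radial push in the face `G` from `p`, extended by the identity;
  continuous on `skel 𝒬 h m ∖ {p}` for an `m`-face `G` of the complex, fixes everything outside
  `relint G`, maps into `skel 𝒬 h m` and off `relint G`, and is branchwise `C¹`;
* `LatticeCube.push_step`: a continuous map `Φ : T → skel 𝒬 h m` (on a compact `T`) with
  `k`-`C¹`-covered image, `k < m`, can be modified to miss the open `m`-face `G` — without moving
  points outside `relint G`, keeping continuity, the skeleton, the smallness, and every lattice
  box containing the old value;
* `LatticeCube.push_dim`, `LatticeCube.push_to_skel`: iterating over the finitely many `m`-faces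
  and over `m = M, M - 1, …, k + 1` pushes `Φ` into `skel 𝒬 h k`, fixing the points whose image
  is already there.

No `sorry`; [folklore].

## References

* A. Hatcher, *Algebraic Topology*, CUP (2002), §4.1, Thm. 4.8 and its proof (pp. 349–351),
  Lemma 4.10. [HatcherAT2002]
-/

noncomputable section

open Set Metric Topology Function

namespace Literature.Topology.Euclidean

namespace LatticeCube

variable {N : ℕ} {h : ℝ}

/-! ### The push extended by the identity -/

/-- **The push off the face `G` from `p`, extended by the identity outside `G`.** [folklore] -/
def spush (G : Face N) (h : ℝ) (p x : Fin N → ℝ) : Fin N → ℝ := by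
  classical
  exact if x ∈ G.carrier h then G.rpush h p x else x

variable {G : Face N} {p : Fin N → ℝ}

/-- On the face the extended push is the radial push. [folklore] -/
theorem spush_of_mem {x : Fin N → ℝ} (hx : x ∈ G.carrier h) : spush G h p x = G.rpush h p x := by
  classical
  simp [spush, hx]

/-- Off the face the extended push is the identity. [folklore] -/
theorem spush_of_not_mem {x : Fin N → ℝ} (hx : x ∉ G.carrier h) : spush G h p x = x := by
  classical
  simp [spush, hx]

section Interior

variable (hp : p ∈ G.relint h)
include hp

/-- **The extended push fixes everything outside the open face.** [folklore] -/
theorem spush_eq_self_of_not_mem_relint {x : Fin N → ℝ} (hx : x ∉ G.relint h) : spush G h p x = x := by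
  by_cases hxc : x ∈ G.carrier h
  · rw [spush_of_mem hxc, Face.rpush_of_not_mem_relint hp hxc hx]
  · exact spush_of_not_mem hxc

/-- The extended push keeps points of the face in the face. [folklore] -/
theorem spush_mem_carrier {x : Fin N → ℝ} (hx : x ∈ G.carrier h) (hxp : x ≠ p) :
    spush G h p x ∈ G.carrier h := by
  rw [spush_of_mem hx]
  exact Face.rpush_mem_carrier hp hx hxp

/-- **The extended push misses the open face** (off `p`). [folklore] -/
theorem spush_not_mem_relint {x : Fin N → ℝ} (hxp : x ≠ p) : spush G h p x ∉ G.relint h := by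
  by_cases hxc : x ∈ G.carrier h
  · rw [spush_of_mem hxc]
    exact Face.rpush_not_mem_relint hp hxc hxp
  · rw [spush_of_not_mem hxc]
    exact fun hx => hxc (Face.relint_subset_carrier hx)

/-- Either a point is fixed by the extended push, or it lies in the open face and is pushed
within the closed face. [folklore] -/
theorem spush_eq_self_or {x : Fin N → ℝ} (hxp : x ≠ p) :
    spush G h p x = x ∨ (x ∈ G.relint h ∧ spush G h p x ∈ G.carrier h) := by
  by_cases hx : x ∈ G.relint h
  · exact Or.inr ⟨hx, spush_mem_carrier hp (Face.relint_subset_carrier hx) hxp⟩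
  · exact Or.inl (spush_eq_self_of_not_mem_relint hp hx)

/-- **Lattice boxes containing a point contain its push.** [folklore] -/
theorem spush_mem_box (hh : 0 < h) {lo hi : Fin N → ℤ} (hlt : ∀ i, lo i < hi i) {x : Fin N → ℝ}
    (hxp : x ≠ p) (hx : x ∈ box lo hi h) : spush G h p x ∈ box lo hi h := by
  rcases spush_eq_self_or hp hxp with h1 | ⟨h1, h2⟩
  · rw [h1]; exact hx
  · exact carrier_subset_box_of_mem_relint hh hlt hx h1 h2

/-- **The extended push is branchwise `C¹`** on `skel 𝒬 h m ∖ {p}`: the identity off the closed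
face, one of the `2N` rational branches on it. [folklore] -/
theorem exists_branch_spush {x : Fin N → ℝ} (hxp : x ≠ p) :
    ∃ j : Option (Fin N × Bool),
      x ∈ (Option.elim j (G.carrier h)ᶜ fun ib => rdom p ib.1 ib.2) ∧
      spush G h p x = Option.elim j x fun ib => G.rbranch h p ib.1 ib.2 x := by
  by_cases hxc : x ∈ G.carrier h
  · obtain ⟨i, b, hdom, heq⟩ := Face.exists_rbranch_eq hp hxc hxp
    exact ⟨some (i, b), hdom, by rw [spush_of_mem hxc, heq]; rfl⟩
  · exact ⟨none, hxc, spush_of_not_mem hxc⟩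

variable {𝒬 : Finset (Fin N → ℤ)} {m : ℕ} (hh : 0 < h) (hG : G ∈ faces 𝒬) (hGm : G.S.card = m)
include hh hG hGm

omit hh in
/-- **The extended push maps `skel 𝒬 h m ∖ {p}` into `skel 𝒬 h m`.** [folklore] -/
theorem spush_mem_skel {x : Fin N → ℝ} (hx : x ∈ skel 𝒬 h m) (hxp : x ≠ p) :
    spush G h p x ∈ skel 𝒬 h m := by
  by_cases hxc : x ∈ G.carrier h
  · exact carrier_subset_skel hG hGm.le (spush_mem_carrier hp hxc hxp)
  · rw [spush_of_not_mem hxc]; exact hx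

omit hG in
/-- **The extended push is continuous on `skel 𝒬 h m ∖ {p}`** (pasting the radial push on the
closed face with the identity on the closed set `skel ∖ relint G`). [folklore] -/
theorem continuousOn_spush : ContinuousOn (spush G h p) (skel 𝒬 h m \ {p}) := by
  set A : Set (Fin N → ℝ) := G.carrier h \ {p} with hA
  set B : Set (Fin N → ℝ) := skel 𝒬 h m \ G.relint h with hB
  have hAcl : closure A ⊆ G.carrier h := (G.isClosed_carrier h).closure_subset_iff.2 sdiff_subset
  have hBcl : IsClosed B := isClosed_skel_diff_relint hh hGm
  -- on `A` the push is `rpush`, on `B` it is the identity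
  have hcA : ContinuousOn (spush G h p) A :=
    (Face.continuousOn_rpush hp).congr fun x hx => spush_of_mem hx.1
  have hcB : ContinuousOn (spush G h p) B :=
    continuousOn_id.congr fun x hx => spush_eq_self_of_not_mem_relint hp hx.2
  have hsub : skel 𝒬 h m \ {p} ⊆ A ∪ B := by
    rintro x ⟨hx, hxp⟩
    by_cases hxc : x ∈ G.carrier h
    · exact Or.inl ⟨hxc, hxp⟩
    · exact Or.inr ⟨hx, fun hxr => hxc (Face.relint_subset_carrier hxr)⟩
  refine ContinuousOn.mono ?_ hsub
  intro x hx
  refine ContinuousWithinAt.union ?_ ?_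
  · by_cases hxA : x ∈ A
    · exact hcA x hxA
    · refine continuousWithinAt_of_notMem_closure fun hxcl => hxA ⟨hAcl hxcl, ?_⟩
      rintro (rfl : x = p)
      rcases hx with hx | hx
      · exact hxA hx
      · exact hx.2 hp
  · by_cases hxB : x ∈ B
    · exact hcB x hxB
    · refine continuousWithinAt_of_notMem_closure ?_
      rwa [hBcl.closure_eq]

end Interior

/-! ### The inverse chart of a face is Lipschitz -/

/-- The inverse chart `coord` of a face is Lipschitz with constant `2 / h`. [folklore] -/
theorem Face.lipschitzWith_coord (hh : 0 < h) (G : Face N) {k : ℕ} (hk : G.S.card = k) :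
    LipschitzWith (Real.toNNReal (2 / h)) (G.coord h hk) := by
  refine LipschitzWith.of_dist_le_mul fun x y => ?_
  have h2 : (0 : ℝ) ≤ 2 / h := by positivity
  rw [Real.coe_toNNReal _ h2]
  refine (dist_pi_le_iff (by positivity)).2 fun j => ?_
  have hxy := dist_le_pi_dist x y (G.S.orderIsoOfFin hk j)
  rw [Real.dist_eq] at hxy ⊢
  simp only [Face.coord]
  have : 2 * ((x (G.S.orderIsoOfFin hk j) - (G.a (G.S.orderIsoOfFin hk j) : ℝ) * h) / h) - 1 -
      (2 * ((y (G.S.orderIsoOfFin hk j) - (G.a (G.S.orderIsoOfFin hk j) : ℝ) * h) / h) - 1) =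
      (2 / h) * (x (G.S.orderIsoOfFin hk j) - y (G.S.orderIsoOfFin hk j)) := by
    field_simp
    ring
  rw [this, abs_mul, abs_of_nonneg h2]
  exact mul_le_mul_of_nonneg_left hxy h2

/-! ### One push step -/

/-- **A `k`-covered set misses a point of every open `m`-face, `m > k`.** [folklore] -/
theorem exists_mem_relint_not_mem (hh : 0 < h) {k m : ℕ} (hkm : k < m) {G : Face N}
    (hGm : G.S.card = m) {A : Set (Fin N → ℝ)} (hA : IsC1Covered k A) :
    ∃ p ∈ G.relint h, p ∉ A := by
  have h1 := hA.not_image_ball_subset hkm (Face.lipschitzWith_coord hh G hGm).lipschitzOnWith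
    (fun y hy => Face.coord_param hh (ball_subset_closedBall hy))
  rw [Face.image_param_ball hh] at h1
  simpa [subset_def] using h1

/-- **Push step** (Hatcher 2002, proof of Thm. 4.8: "compose with the radial projection"): a map
`Φ`, continuous on a set `T` with values in `skel 𝒬 h m` and `k`-covered image, `k < m`, can be
pushed off the open `m`-face `G` of the complex: the new map is continuous on `T`, still valued
in `skel 𝒬 h m` with `k`-covered image, misses `relint G`, agrees with `Φ` wherever `Φ ∉ relint G`,
and keeps every lattice box containing the old value. [cite: HatcherAT2002, Thm. 4.8 (proof, p. 350)] -/
theorem push_step (hh : 0 < h) {𝒬 : Finset (Fin N → ℤ)} {k m : ℕ} (hkm : k < m) {G : Face N}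
    (hG : G ∈ faces 𝒬) (hGm : G.S.card = m) {X : Type*} {T : Set X} {Φ : X → (Fin N → ℝ)}
    (hΦs : MapsTo Φ T (skel 𝒬 h m)) (hsm : IsC1Covered k (Φ '' T)) :
    ∃ p ∈ G.relint h, (∀ x ∈ T, Φ x ≠ p) ∧
      MapsTo (spush G h p ∘ Φ) T (skel 𝒬 h m) ∧ IsC1Covered k ((spush G h p ∘ Φ) '' T) ∧
      (∀ x ∈ T, (spush G h p ∘ Φ) x ∉ G.relint h) ∧
      (∀ x ∈ T, Φ x ∉ G.relint h → (spush G h p ∘ Φ) x = Φ x) ∧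
      (∀ x ∈ T, ∀ lo hi : Fin N → ℤ, (∀ i, lo i < hi i) → Φ x ∈ box lo hi h →
        (spush G h p ∘ Φ) x ∈ box lo hi h) := by
  obtain ⟨p, hp, hpA⟩ := exists_mem_relint_not_mem hh hkm hGm hsm
  have hne : ∀ x ∈ T, Φ x ≠ p := fun x hx heq => hpA ⟨x, hx, heq⟩
  refine ⟨p, hp, hne, fun x hx => spush_mem_skel hp hG hGm (hΦs hx) (hne x hx), ?_,
    fun x hx => spush_not_mem_relint hp (hne x hx),
    fun x hx hxr => spush_eq_self_of_not_mem_relint hp hxr,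
    fun x hx lo hi hlt hxb => spush_mem_box hp hh hlt (hne x hx) hxb⟩
  rw [image_comp]
  refine hsm.image_of_branches (J := Option (Fin N × Bool)) (spush G h p)
    (fun j x => Option.elim j x fun ib => G.rbranch h p ib.1 ib.2 x)
    (fun j => Option.elim j (G.carrier h)ᶜ fun ib => rdom p ib.1 ib.2)
    (fun j => ?_) (fun j => ?_) ?_
  · cases j with
    | none => exact (G.isClosed_carrier h).isOpen_compl
    | some ib => exact isOpen_rdom p ib.1 ib.2
  · cases j with
    | none => exact contDiffOn_id
    | some ib => exact Face.contDiffOn_rbranch ib.1 ib.2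
  · rintro _ ⟨x, hx, rfl⟩
    exact exists_branch_spush hp (hne x hx)

/-- Continuity is preserved by a push step. [folklore] -/
theorem continuousOn_spush_comp (hh : 0 < h) {𝒬 : Finset (Fin N → ℤ)} {m : ℕ} {G : Face N}
    (hGm : G.S.card = m) {p : Fin N → ℝ} (hp : p ∈ G.relint h)
    {X : Type*} [TopologicalSpace X] {T : Set X} {Φ : X → (Fin N → ℝ)} (hΦ : ContinuousOn Φ T)
    (hΦs : MapsTo Φ T (skel 𝒬 h m)) (hne : ∀ x ∈ T, Φ x ≠ p) :
    ContinuousOn (spush G h p ∘ Φ) T :=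
  (continuousOn_spush hp hh hGm).comp hΦ fun x hx => ⟨hΦs hx, hne x hx⟩

/-! ### Clearing a whole dimension, and pushing down to the `k`-skeleton -/

/-- The data carried through the induction: a map on `T`, continuous, valued in `skel 𝒬 h m`,
with `k`-covered image, agreeing with `Φ₀` where `Φ₀` already lies in `skel 𝒬 h k`, and keeping
the lattice boxes of `Φ₀`. [folklore] -/
structure PushData (𝒬 : Finset (Fin N → ℤ)) (h : ℝ) (k m : ℕ) {X : Type*} [TopologicalSpace X]
    (T : Set X) (Φ₀ : X → (Fin N → ℝ)) where
  /-- the current map -/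
  Φ : X → (Fin N → ℝ)
  continuousOn : ContinuousOn Φ T
  mapsTo : MapsTo Φ T (skel 𝒬 h m)
  small : IsC1Covered k (Φ '' T)
  agree : ∀ x ∈ T, Φ₀ x ∈ skel 𝒬 h k → Φ x = Φ₀ x
  box : ∀ x ∈ T, ∀ lo hi : Fin N → ℤ, (∀ i, lo i < hi i) → Φ₀ x ∈ box lo hi h → Φ x ∈ box lo hi h

/-- **Clearing the `m`-faces one at a time**: for every finite set `𝓕` of `m`-faces of the
complex there is push data missing the relative interiors of all faces in `𝓕`. [folklore] -/
theorem push_finset (hh : 0 < h) {𝒬 : Finset (Fin N → ℤ)} {k m : ℕ} (hkm : k < m)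
    {X : Type*} [TopologicalSpace X] {T : Set X} {Φ₀ : X → (Fin N → ℝ)}
    (D : PushData 𝒬 h k m T Φ₀) (𝓕 : Finset (Face N)) (h𝓕 : ∀ G ∈ 𝓕, G ∈ faces 𝒬 ∧ G.S.card = m) :
    ∃ D' : PushData 𝒬 h k m T Φ₀, ∀ G ∈ 𝓕, ∀ x ∈ T, D'.Φ x ∉ G.relint h := by
  classical
  induction 𝓕 using Finset.induction with
  | empty => exact ⟨D, fun G hG => absurd hG (Finset.notMem_empty G)⟩
  | insert G 𝓕 hG𝓕 ih =>
    obtain ⟨D₁, hD₁⟩ := ih fun G' hG' => h𝓕 G' (Finset.mem_insert_of_mem hG')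
    obtain ⟨hG, hGm⟩ := h𝓕 G (Finset.mem_insert_self G 𝓕)
    obtain ⟨p, hp, hne, hmaps, hsmall, hmiss, hagree, hbox⟩ :=
      push_step hh hkm hG hGm D₁.mapsTo D₁.small
    refine ⟨⟨spush G h p ∘ D₁.Φ, continuousOn_spush_comp hh hGm hp D₁.continuousOn D₁.mapsTo hne,
      hmaps, hsmall, fun x hx hx0 => ?_, fun x hx lo hi hlt hxb => hbox x hx lo hi hlt
        (D₁.box x hx lo hi hlt hxb)⟩, ?_⟩
    · -- points with `Φ₀ x ∈ skel k` are fixed: `D₁.Φ x = Φ₀ x ∈ skel k` avoids `relint G`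
      have h1 : D₁.Φ x = Φ₀ x := D₁.agree x hx hx0
      have h2 : D₁.Φ x ∉ G.relint h := by
        rw [h1]
        intro hrel
        exact Face.not_mem_skel_of_mem_relint hh (by rw [hGm]; exact hkm) hrel hx0
      rw [hagree x hx h2, h1]
    · intro G' hG' x hx
      change (spush G h p ∘ D₁.Φ) x ∉ G'.relint h
      rcases Finset.mem_insert.1 hG' with rfl | hG'
      · exact hmiss x hx
      · -- faces already cleared stay cleared: the push moves points only inside `carrier G`
        intro hrel
        have hx1 : D₁.Φ x ∉ G'.relint h := hD₁ G' hG' x hx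
        rcases spush_eq_self_or hp (hne x hx) with heq | ⟨-, hcar⟩
        · rw [Function.comp_apply, heq] at hrel
          exact hx1 hrel
        · -- the pushed point lies on `∂G ⊆ skel (m-1)`, never in an open `m`-face
          have hbd : (spush G h p ∘ D₁.Φ) x ∉ G.relint h := hmiss x hx
          have hsk : (spush G h p ∘ D₁.Φ) x ∈ skel 𝒬 h (m - 1) :=
            Face.mem_skel_of_mem_carrier_diff_relint hG (by omega) hcar hbd
          exact Face.not_mem_skel_of_mem_relint hh
            (by rw [(h𝓕 G' (Finset.mem_insert_of_mem hG')).2]; omega) hrel hsk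

/-- **Clearing dimension `m`**: push data valued in `skel 𝒬 h m`, `k < m`, can be pushed into
`skel 𝒬 h (m - 1)`. [folklore] -/
theorem push_dim (hh : 0 < h) {𝒬 : Finset (Fin N → ℤ)} {k m : ℕ} (hkm : k < m)
    {X : Type*} [TopologicalSpace X] {T : Set X} {Φ₀ : X → (Fin N → ℝ)}
    (D : PushData 𝒬 h k m T Φ₀) : Nonempty (PushData 𝒬 h k (m - 1) T Φ₀) := by
  classical
  set 𝓕 : Finset (Face N) := ((faces_finite 𝒬).subset (fun G (hG : G ∈ {G : Face N |
    G ∈ faces 𝒬 ∧ G.S.card = m}) => hG.1)).toFinset with h𝓕def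
  have h𝓕 : ∀ G, G ∈ 𝓕 ↔ G ∈ faces 𝒬 ∧ G.S.card = m := fun G => by
    rw [h𝓕def, Set.Finite.mem_toFinset]; rfl
  obtain ⟨D', hD'⟩ := push_finset hh hkm D 𝓕 fun G hG => (h𝓕 G).1 hG
  refine ⟨⟨D'.Φ, D'.continuousOn, fun x hx => ?_, D'.small, D'.agree, D'.box⟩⟩
  obtain ⟨F, hF, hFm, hxF⟩ := mem_skel.1 (D'.mapsTo hx)
  rcases hFm.lt_or_eq with hlt | heq
  · exact mem_skel.2 ⟨F, hF, by omega, hxF⟩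
  · exact Face.mem_skel_of_mem_carrier_diff_relint hF (by omega) hxF
      (hD' F ((h𝓕 F).2 ⟨hF, heq⟩) x hx)

/-- **Pushing down to the `k`-skeleton**: a map continuous on `T` with values in `skel 𝒬 h m`
and `k`-covered image (`k ≤ m`) can be deformed — fixing the points already mapped into
`skel 𝒬 h k`, and within the lattice boxes of the original values — to a continuous map into
`skel 𝒬 h k` with `k`-covered image (Hatcher 2002, proof of Thm. 4.8: induction over the cells of
dimension `> k`). [cite: HatcherAT2002, Thm. 4.8 (proof)] -/
theorem push_to_skel (hh : 0 < h) {𝒬 : Finset (Fin N → ℤ)} {k : ℕ} {X : Type*}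
    [TopologicalSpace X] {T : Set X} {Φ₀ : X → (Fin N → ℝ)} :
    ∀ m : ℕ, k ≤ m → PushData 𝒬 h k m T Φ₀ → Nonempty (PushData 𝒬 h k k T Φ₀) := by
  intro m
  induction m with
  | zero =>
    intro hk D
    have : k = 0 := by omega
    subst this
    exact ⟨D⟩
  | succ m ih =>
    intro hk D
    rcases Nat.eq_or_lt_of_le hk with heq | hlt
    · subst heq; exact ⟨D⟩
    · obtain ⟨D'⟩ := push_dim hh (by omega) D
      exact ih (by omega) (by simpa using D')

end LatticeCube

end Literature.Topology.Euclidean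

end
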